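import Literature.NumberTheory.EllipticCurves.Tian2014.ClassSevenFamilyDescentProofs
import HarnessLib

/-!
# The class-`5` odd-graph family `n = p₀p₁⋯p_k ≡ 5 (mod 8)` (all `pᵢ ≡ 1 (mod 4)`, `G(n)` odd): `s(n) = 1`,
# `r₄(Cl ℚ(√−n)) = 0`, hence FULL BSD via Li–Liu–Tian 2024 uniformly in `k`; and Tian's (1.1) on his class-`5` family

HONEST FRAMING (cell `b2b-bsdres`, sub-lane «bsd-p2», literature seat `p2-lit-1`; sibling of
`Tian2014/ClassSevenFamilyDescentProofs.lean`): this file PROVES theorems — NO definition, NO named fact, NO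
`sorry`.  Class-group statements are MODULO the displayed Rédei–Reichardt fact (`hR`, Li–Ma 2008 Thm. 0.4,
p319707); the BSD statements of §2 are MODULO, in addition, the displayed JOURNAL fact
`LiLiuTian2024.thm12_bsd_congruentNumberCurve` (`hLLT`, Li–Liu–Tian 2024 Thm. 1.2); §3 displays Tian 2014
Thm. 1.3 (`h13`).  What is proved is `𝔽₂`-linear algebra on Monsky's matrix and on two Rédei matrices, plus
the bookkeeping that feeds the existing doors `noIdealClassOfOrderFour_of_card_ker`,
`forall_bsdp_congruentNumberCurve_of_thm12`, `condition11_of_card_ker`.  A FAMILY of pairs closed modulo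
displayed facts — not a class closure; nothing booked; no mark moved.

## The family

`p : Fin (k+1) → ℕ` injective primes, ALL `pᵢ ≡ 1 (mod 4)` (`h4`), `n = ∏ pᵢ ≡ 5 (mod 8)` (`h5`; equivalently an
odd number of the `pᵢ` are `≡ 5 (mod 8)`, §0), and `G(n)` odd in Feng's kernel form
`hG : ∀ v, A v = 0 → v = 0 ∨ v = (1,…,1)`, `A = legendreMatrix p` (symmetric by reciprocity).  This is the
intersection of Li–Liu–Tian's family [Li–Liu–Tian 2024 Thm. 1.2: "`n ≡ 5 (mod 8)` square-free, all prime
factors `≡ 1 (mod 4)`, `ℚ(√−n)` has no ideal class of order `4` ⟹ full BSD for `y² = x³ − n²x`"] with the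
odd-graph locus — §2 proves that on the odd-graph locus the class-group hypothesis HOLDS (mod `hR`).  Tian's
own class-`5` family (Thm. 1.3 with `m = n ≡ 5 (mod 8)`: `p₀ ≡ 5`, `pᵢ ≡ 1 (mod 8)` for `i ≥ 1`, (1.1)) is the
sub-family with exactly one prime `≡ 5 (mod 8)`; §3 treats it.

## What is PROVED (uniformly in `k`)

* §0 `odd_card_filter_five`, `sum_addLegendreSym_two_eq_one`: `#{i : pᵢ ≡ 5 (mod 8)}` is odd, i.e. the trace
  of Monsky's `D₂` is `1`; `D₋₂ = D₂` (`legendreDiagonal_neg_two_eq_two`).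
* §1 `monskyMatrixOdd_mulVec_eq_zero_iff_caseFive`, `card_ker_monskyMatrixOdd_caseFive`,
  `monskySelmerRankOdd_caseFive`: `ker M = {(0;0), (1;1)}`, `#ker M = 2`, `s(n) = 1` — Tian's (5.1) for
  `m = n ≡ 5 (mod 8)` [arXiv:1210.8231 p. 29 L6–L8] in Monsky's currency, on the whole odd-graph family.
* §2 `redeiMatrix_four_mulVec_eq_zero_iff`, `card_ker_redeiMatrix_four_caseFive`: `RM(−4n)` on `(2; p₀,…,p_k)` is
  `(r cᵀ; 0 A)` (`c_b = [p_b ≡ 5 (8)]`, `(−4/pₐ) = +1`), kernel `{0, 1}`; hence (mod `hR`)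
  **`noIdealClassOfOrderFour_caseFive : NoIdealClassOfOrderFour (−n)`** and `odd_genusClassNumber_caseFive`; and
  (mod `hR`, `hLLT`) **`bsd_congruentNumberCurve_caseFive`** (`rank = r_an = 1`, `BSDTriple`) and
  **`forall_bsdp_congruentNumberCurve_caseFive : ∀ ℓ prime, BSD(E_n, ℓ)`** — FULL BSD at EVERY prime incl. `2`
  for every member, every `k`; the case `k = 1` is the tree's `forall_bsdp_congruentNumberCurve_p_mul_q`
  (`LiLiuTian2024/CongruentNumberRedeiFamilies.lean`).
* §3 Tian's class-`5` family: `card_ker_redeiMatrix_eight_caseFive` (`RM(−8n) = (1 e₀ᵀ; e₀ A + E₀₀)`, kernel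
  `{0, 1}`), **`condition11_caseFive (hR)`** — Lemma 5.1 direction (1) ⟹ (1.1) [p. 28 L2–L16] as a theorem in
  the case `n ≡ ±3 (mod 8)` (`dim 𝒜[4]/𝒜[2] = 0`), and **`thm13_caseFive (h13) (hR)`** — Thm. 1.3 applied with
  (1.1) discharged: rank `1 =` analytic rank, `Ш` finite odd.

AT `p = 2`: §2 is a full-BSD statement INCLUDING the `2`-part (as printed by Li–Liu–Tian: "one can also check
that the 2-part of BSD holds by noting that `dim Sel₂/Im(tors) = 1`", arXiv:1605.01481 p. 2 L17–L21 — which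
is exactly §1 here); no prime is excluded by any hypothesis (`E_n` has additive reduction at `2`, potentially
good ORDINARY at the `pᵢ ≡ 1 (mod 4)`).  NOT treated: `ρ(n)` (Faulkner–James' bound in the tree is printed for
`n ≡ ±1 (mod 8)` only) — not needed here, since Li–Liu–Tian's theorem is the door.

## References

* [Tian2014] Y. Tian, Camb. J. Math. 2 (2014) = arXiv:1210.8231: Thm. 1.3 (p. 2 L5–L15), Lemma 5.1
  (p. 28 L2–L35), Lemma 5.3 and (5.1) (p. 28 L71 – p. 29 L32).
* [LiLiuTian2024] Y. Li, Y. Liu, Y. Tian, Thm. 1.2 (arXiv:1605.01481 p. 2 L5–L21).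
* [TianYuanZhang2017] Y. Tian, X. Yuan, S.-W. Zhang, Asian J. Math. 21 (2017) = arXiv:1411.4728, Cor. 1.4
  (chunk p0003 L13–L50: `n ≡ 5 (mod 8)` with `A₀` or `B₁`).
* [HeathBrown1994SelmerCongruentII] D. R. Heath-Brown, appendix by P. Monsky, Invent. Math. 118 (1994),
  typescript p. 39 L10–L33.
* [LiMa2008] Y. Li, L. Ma, Acta Arith. 134 (2008), Lemma 0.1, Def. 0.2, Thm. 0.4 (Rédei–Reichardt).
* [Feng1996NonCongruent] K. Feng, Acta Arith. 75 (1996), §2 Lemma 2.2.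
* [IrelandRosen1990] K. Ireland, M. Rosen, GTM 84, Ch. 5 §§1–2.  [Cox2013] §5.B.  [HardyWright2008] §17.8.
* [Miller2011LMS] R. L. Miller, LMS J. Comput. Math. 14 (2011), Def. 1.1 (`BSD(E, p)`).
* Tree: `Tian2014/ClassSevenFamilyDescentProofs.lean` (p2-lit-1 GEN 7, p326865),
  `LiLiuTian2024/{CongruentNumberFullBSD, CongruentNumberRedeiFamilies}.lean`,
  `HeathBrown1994/CongruentTwoSelmerOddGraphFamilies.lean`, `QuadraticFields/RedeiMatrixFourRank.lean`;
  HOME/p2/LIT-STATUS.md §T1 addendum 12; unit `b2b-bsdres-p2-lit-1` GEN 7.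
-/

noncomputable section

open scoped Classical

open Matrix Finset WeierstrassCurve Literature.NumberTheory.EllipticCurves
  Literature.NumberTheory.EllipticCurves.HeathBrown1994
  Literature.NumberTheory.EllipticCurves.HeathBrown1994.Families
  Literature.NumberTheory.EllipticCurves.TianYuanZhang2017
  Literature.NumberTheory.EllipticCurves.LiLiuTian2024
  Literature.NumberTheory.EllipticCurves.LiLiuTian2024.RedeiFamilies
  Literature.NumberTheory.QuadraticFields.RedeiReichardt

set_option autoImplicit false

namespace Literature.NumberTheory.EllipticCurves.Tian2014

variable {k : ℕ} (p : Fin (k + 1) → ℕ)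

/-! ## §0 The family `n ≡ 5 (mod 8)`, all `pᵢ ≡ 1 (mod 4)`: the bits `c_b = [p_b ≡ 5 (mod 8)]` have odd sum -/

/-- All primes of the family are odd. [cite: LiLiuTian2024, Thm. 1.2 (hypothesis: prime factors ≡ 1 mod 4)] -/
theorem odd_of_mod_four (h4 : ∀ i, p i % 4 = 1) (i : Fin (k + 1)) : Odd (p i) :=
  Nat.odd_iff.mpr (by have := h4 i; omega)

/-- `[(2/q) = −1] = [q ≡ 5 (mod 8)]` for `q ≡ 1 (mod 4)` (second supplement).
[cite: IrelandRosen1990, Ch. 5 §2 Prop. 5.2.2] -/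
theorem addLegendreSym_two_eq_ite {q : ℕ} (h4 : q % 4 = 1) :
    addLegendreSym 2 q = if q % 8 = 5 then 1 else 0 := by
  by_cases h : q % 8 = 5
  · rw [if_pos h]; exact addLegendreSym_of_eq_neg_one (jacobiSym_two_eq_neg_one (Or.inr h))
  · rw [if_neg h]; exact addLegendreSym_of_eq_one (jacobiSym_two_eq_one (Or.inl (by omega)))

/-- `(−2/q) = (2/q)` for `q ≡ 1 (mod 4)`: `D₋₂ = D₂` on the family. [cite: IrelandRosen1990, Ch. 5 §2 Prop. 5.2.2] -/
theorem legendreDiagonal_neg_two_eq_two (h4 : ∀ i, p i % 4 = 1) :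
    legendreDiagonal p (-2) = legendreDiagonal p 2 := by
  unfold legendreDiagonal
  congr 1
  ext j
  rw [addLegendreSym_def, addLegendreSym_def, show (-2 : ℤ) = -(2 : ℤ) by rfl,
    jacobiSym.neg _ (odd_of_mod_four p h4 j), ZMod.χ₄_nat_one_mod_four (h4 j), one_mul]

/-- The residue of a product of primes `≡ 1 (mod 4)` modulo `8` is `5^{#{pᵢ ≡ 5 (mod 8)}}`: `1` or `5`
according to the parity of that count. [cite: HardyWright2008, §17.8] -/
theorem prod_mod_eight_eq_ite (h4 : ∀ i, p i % 4 = 1) (s : Finset (Fin (k + 1))) :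
    (∏ i ∈ s, p i) % 8 = if Even (s.filter fun i => p i % 8 = 5).card then 1 else 5 := by
  induction s using Finset.induction_on with
  | empty => simp
  | insert a s ha ih =>
    rw [Finset.prod_insert ha, Nat.mul_mod, ih, Finset.filter_insert]
    have ha8 : p a % 8 = 1 ∨ p a % 8 = 5 := by have := h4 a; omega
    rcases ha8 with h1 | h5
    · rw [if_neg (show ¬ (p a % 8 = 5) by omega), h1]
      split_ifs <;> norm_num
    · rw [if_pos h5, Finset.card_insert_of_notMem (by simp [ha]), h5]
      by_cases he : Even (s.filter fun i => p i % 8 = 5).card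
      · have hne : ¬ Even ((s.filter fun i => p i % 8 = 5).card + 1) := by
          rw [Nat.even_add_one]; exact not_not.mpr he
        norm_num [if_pos he, if_neg hne]
      · have he' : Even ((s.filter fun i => p i % 8 = 5).card + 1) := by
          rw [Nat.even_add_one]; exact he
        norm_num [if_neg he, if_pos he']

/-- On the family `n ≡ 5 (mod 8)` an ODD number of the `pᵢ` are `≡ 5 (mod 8)`.
[cite: LiLiuTian2024, Thm. 1.2 (hypotheses n ≡ 5 mod 8, prime factors ≡ 1 mod 4)] -/
theorem odd_card_filter_five (h4 : ∀ i, p i % 4 = 1) (h5 : (∏ i, p i) % 8 = 5) :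
    Odd (univ.filter fun i => p i % 8 = 5).card := by
  have h := prod_mod_eight_eq_ite p h4 univ
  rw [h5] at h
  by_contra hodd
  rw [Nat.not_odd_iff_even] at hodd
  rw [if_pos hodd] at h
  exact absurd h (by norm_num)

/-- `Σ_b [p_b ≡ 5 (mod 8)] = 1` in `𝔽₂` on the family. [cite: LiLiuTian2024, Thm. 1.2 (hypotheses)] -/
theorem sum_ite_five_eq_one (h4 : ∀ i, p i % 4 = 1) (h5 : (∏ i, p i) % 8 = 5) :
    ∑ b, (if p b % 8 = 5 then (1 : ZMod 2) else 0) = 1 := by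
  rw [Finset.sum_boole, ZMod.natCast_eq_one_iff_odd]
  exact odd_card_filter_five p h4 h5

/-- `Σ_a [(2/pₐ) = −1] = 1` in `𝔽₂` on the family: the trace of `D₂` is `1`. [cite: IrelandRosen1990, Ch. 5 §2 Prop. 5.2.2] -/
theorem sum_addLegendreSym_two_eq_one (h4 : ∀ i, p i % 4 = 1) (h5 : (∏ i, p i) % 8 = 5) :
    ∑ a, addLegendreSym 2 (p a) = 1 := by
  rw [← sum_ite_five_eq_one p h4 h5]
  exact Finset.sum_congr rfl fun a _ => addLegendreSym_two_eq_ite (h4 a)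

/-! ## §1 Monsky's matrix on the family: kernel `{0, (1;1)}`, `s(n) = 1` -/

/-- **Kernel of Monsky's matrix on the class-`5` odd-graph family.**  With `D := D₂ = D₋₂` (all `pᵢ ≡ 1 (mod 4)`),
`M = (A + D, D; D, A + D)` and `M(x; y) = 0` iff `Ax = Ay = D(x + y)`; then `A(x + y) = 0`, so `x + y ∈ {0, 1}`
(`G` odd); `x + y = 1` is impossible since `Σₐ (Ax)ₐ = 0` (symmetric `A`) while `Σₐ (D1)ₐ = #{pₐ ≡ 5 (8)} ≡ 1`;
and `x = y` forces `Ax = 0`, `x ∈ {0, 1}`.  So `ker M = {(0;0), (1;1)}` — `s(n) = 1`, Tian's (5.1) on his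
class `m = n ≡ 5 (mod 8)` in Monsky's currency, here for ALL tuples of primes `≡ 1 (mod 4)` with `G(n)` odd.
[cite: Tian2014, Lemma 5.3 and (5.1) (arXiv p. 28 L71 – p. 29 L32)]
[cite: HeathBrown1994SelmerCongruentII, Appendix (Monsky), typescript p. 39 L27–L33 (the matrix; evaluation ours)] -/
theorem monskyMatrixOdd_mulVec_eq_zero_iff_caseFive (h4 : ∀ i, p i % 4 = 1) (h5 : (∏ i, p i) % 8 = 5)
    (hG : ∀ v, legendreMatrix p *ᵥ v = 0 → v = 0 ∨ v = fun _ => 1)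
    (z : Fin (k + 1) ⊕ Fin (k + 1) → ZMod 2) :
    monskyMatrixOdd p *ᵥ z = 0 ↔ z = 0 ∨ z = fun _ => 1 := by
  have hodd := odd_of_mod_four p h4
  have hsymm := legendreMatrix_transpose_eq p hodd (fun i _ => h4 i)
  have hD := legendreDiagonal_neg_two_eq_two p h4
  set D := legendreDiagonal p 2 with hDdef
  constructor
  · intro hz
    obtain ⟨x, y, rfl⟩ : ∃ x y, z = Sum.elim x y :=
      ⟨z ∘ Sum.inl, z ∘ Sum.inr, (Sum.elim_comp_inl_inr z).symm⟩
    rw [monskyMatrixOdd, hD, Matrix.fromBlocks_mulVec] at hz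
    simp only [Sum.elim_comp_inl, Sum.elim_comp_inr] at hz
    have htop : (legendreMatrix p + D) *ᵥ x + D *ᵥ y = 0 := by
      funext i; have := congr_fun hz (Sum.inl i); simpa only [Sum.elim_inl, Pi.zero_apply] using this
    have hbot : D *ᵥ x + (legendreMatrix p + D) *ᵥ y = 0 := by
      funext i; have := congr_fun hz (Sum.inr i); simpa only [Sum.elim_inr, Pi.zero_apply] using this
    have hAx : legendreMatrix p *ᵥ x = D *ᵥ (x + y) := by
      rw [Matrix.add_mulVec, add_assoc, ← Matrix.mulVec_add] at htop
      rw [eq_neg_of_add_eq_zero_left htop, neg_eq_self_pi]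
    have hAy : legendreMatrix p *ᵥ y = D *ᵥ (x + y) := by
      have h2 : legendreMatrix p *ᵥ y + D *ᵥ (x + y) = 0 := by
        rw [Matrix.add_mulVec] at hbot
        rw [Matrix.mulVec_add]
        calc legendreMatrix p *ᵥ y + (D *ᵥ x + D *ᵥ y)
            = D *ᵥ x + (legendreMatrix p *ᵥ y + D *ᵥ y) := by abel
          _ = 0 := hbot
      rw [eq_neg_of_add_eq_zero_left h2, neg_eq_self_pi]
    have hsum : legendreMatrix p *ᵥ (x + y) = 0 := by
      rw [Matrix.mulVec_add, hAx, hAy]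
      funext a
      exact CharTwo.add_self_eq_zero _
    rcases hG (x + y) hsum with h0 | h1
    · -- `y = x`, then `Ax = 0`
      have hxy : x = y := by rw [eq_neg_of_add_eq_zero_left h0, neg_eq_self_pi]
      subst hxy
      rw [h0, Matrix.mulVec_zero] at hAx
      rcases hG x hAx with hx | hx
      · left; subst hx; funext i; cases i <;> rfl
      · right; subst hx; funext i; cases i <;> rfl
    · -- `x + y = 1`: the coordinate sum of `Ax = D1` is `1 ≠ 0`
      exfalso
      rw [h1] at hAx
      have hs := sum_legendreMatrix_mulVec_eq_zero p hsymm x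
      rw [hAx] at hs
      simp only [hDdef, legendreDiagonal, Matrix.mulVec_diagonal, mul_one] at hs
      rw [sum_addLegendreSym_two_eq_one p h4 h5] at hs
      exact one_ne_zero hs
  · rintro (rfl | rfl)
    · exact Matrix.mulVec_zero _
    · rw [monskyMatrixOdd, hD, Matrix.fromBlocks_mulVec]
      have h1 : ((fun _ => (1 : ZMod 2)) : Fin (k + 1) ⊕ Fin (k + 1) → ZMod 2) ∘ Sum.inl = fun _ => 1 := rfl
      have h2 : ((fun _ => (1 : ZMod 2)) : Fin (k + 1) ⊕ Fin (k + 1) → ZMod 2) ∘ Sum.inr = fun _ => 1 := rfl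
      rw [h1, h2, Matrix.add_mulVec, legendreMatrix_mulVec_one, zero_add]
      have hDD : D *ᵥ (fun _ => (1 : ZMod 2)) + D *ᵥ (fun _ => 1) = 0 := by
        funext a; exact CharTwo.add_self_eq_zero _
      rw [hDD]
      funext i; cases i <;> rfl

/-- **`#ker M = 2` (`s(n) = 1`) on the class-`5` odd-graph family** (all `pᵢ ≡ 1 (mod 4)`, `n ≡ 5 (mod 8)`, `G(n)`
odd), uniformly in `k` — the Monsky kernel count with NO per-`n` certificate.
[cite: Tian2014, (5.1) (arXiv p. 29)] [cite: HeathBrown1994SelmerCongruentII, Appendix (Monsky), typescript p. 39 L27–L33] -/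
theorem card_ker_monskyMatrixOdd_caseFive (h4 : ∀ i, p i % 4 = 1) (h5 : (∏ i, p i) % 8 = 5)
    (hG : ∀ v, legendreMatrix p *ᵥ v = 0 → v = 0 ∨ v = fun _ => 1) :
    Fintype.card {z : Fin (k + 1) ⊕ Fin (k + 1) → ZMod 2 // monskyMatrixOdd p *ᵥ z = 0} = 2 := by
  rw [Fintype.card_of_subtype ({0, fun _ => 1} : Finset (Fin (k + 1) ⊕ Fin (k + 1) → ZMod 2))
    (fun z => by
      rw [Finset.mem_insert, Finset.mem_singleton]
      exact (monskyMatrixOdd_mulVec_eq_zero_iff_caseFive p h4 h5 hG z).symm)]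
  refine Finset.card_pair fun h => ?_
  exact zero_ne_one (congr_fun h (Sum.inl 0))

/-- "`s(D) = 2n − rank M`" read off a kernel count of `2`: `s = 1`.
[cite: HeathBrown1994SelmerCongruentII, Appendix (Monsky), typescript p. 39 L1–L9 and L33] -/
theorem monskySelmerRankOdd_eq_one_of_card_ker
    (h2 : Fintype.card {z : Fin (k + 1) ⊕ Fin (k + 1) → ZMod 2 // monskyMatrixOdd p *ᵥ z = 0} = 2) :
    monskySelmerRankOdd p = 1 := by
  have hcard := natCard_ker_mulVecLin_eq (monskyMatrixOdd p)
  have h2' : Nat.card (LinearMap.ker (monskyMatrixOdd p).mulVecLin) = 2 := by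
    rw [Nat.card_congr (Equiv.subtypeEquivRight (q := fun v => monskyMatrixOdd p *ᵥ v = 0)
      fun v => by rw [LinearMap.mem_ker, Matrix.mulVecLin_apply]), Nat.card_eq_fintype_card]
    exact h2
  rw [h2', Fintype.card_sum, Fintype.card_fin] at hcard
  unfold monskySelmerRankOdd
  have key : k + 1 + (k + 1) - (monskyMatrixOdd p).rank = 1 := by
    by_contra hne
    rcases Nat.lt_or_gt_of_ne hne with hlt | hgt
    · have h0 : k + 1 + (k + 1) - (monskyMatrixOdd p).rank = 0 := by omega
      rw [h0, pow_zero] at hcard; omega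
    · have : (2 : ℕ) ^ 2 ≤ 2 ^ (k + 1 + (k + 1) - (monskyMatrixOdd p).rank) :=
        Nat.pow_le_pow_right two_pos hgt
      omega
  omega

/-- `s(n) = 2(k+1) − rank M = 1` on the class-`5` odd-graph family.
[cite: HeathBrown1994SelmerCongruentII, Appendix (Monsky), typescript p. 39 L33] [cite: Tian2014, (5.1) (arXiv p. 29)] -/
theorem monskySelmerRankOdd_caseFive (h4 : ∀ i, p i % 4 = 1) (h5 : (∏ i, p i) % 8 = 5)
    (hG : ∀ v, legendreMatrix p *ᵥ v = 0 → v = 0 ∨ v = fun _ => 1) :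
    monskySelmerRankOdd p = 1 :=
  monskySelmerRankOdd_eq_one_of_card_ker p (card_ker_monskyMatrixOdd_caseFive p h4 h5 hG)

/-! ## §2 The Rédei matrix `RM(−4n)` of `ℚ(√−n)` on the family: kernel `{0, 1}`, `r₄ = 0`; FULL BSD via Li–Liu–Tian -/

section RedeiFourN

variable {n : ℕ}

/-- `D₂ = −4` for `D = −4n`, `n ≡ 1 (mod 4)`. [cite: LiMa2008, Lemma 0.1 (p. 279)] -/
theorem primeDisc_two_of_mod_four_one (hn4 : n % 4 = 1) : primeDisc n 2 = -4 := by
  unfold primeDisc; rw [if_pos rfl, if_pos hn4]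

/-- Row of the prime `2` in `RM(−4n)` on the family: `r_{2,b} = [(p_b/2) = −1] = [p_b ≡ 5 (mod 8)]` (`D_b = p_b`).
[cite: LiMa2008, Def. 0.2 (p. 279)] [cite: Cox2013, §5.B ((D/2) = −1 iff D ≡ 5 mod 8)] -/
theorem redeiMatrix_four_zero_succ (h4 : ∀ i, p i % 4 = 1) (b : Fin (k + 1)) :
    redeiMatrix n (Fin.cons 2 p) 0 b.succ = if p b % 8 = 5 then 1 else 0 := by
  have hp2 : p b ≠ 2 := by have := h4 b; omega
  rw [redeiMatrix_apply_of_ne _ _ (Fin.succ_ne_zero b).symm, Fin.cons_zero, Fin.cons_succ,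
    primeDisc_of_ne_two _ hp2, if_pos (h4 b), kroneckerBit_two]
  by_cases h : p b % 8 = 5
  · rw [if_pos h, if_pos]
    have : ((p b : ℕ) : ℤ) % 8 = 5 := by exact_mod_cast h
    exact this
  · rw [if_neg h, if_neg]
    intro h'
    apply h
    have : ((p b : ℕ) : ℤ) % 8 = ((p b % 8 : ℕ) : ℤ) := by push_cast; rfl
    omega

/-- Column of the prime `2` in `RM(−4n)` on the family vanishes: `(−4/pₐ) = +1` for `pₐ ≡ 1 (mod 4)`.
[cite: LiMa2008, Def. 0.2 (p. 279)] [cite: IrelandRosen1990, Ch. 5 §2 Prop. 5.2.2] -/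
theorem redeiMatrix_four_succ_zero (hp : ∀ i, (p i).Prime) (h4 : ∀ i, p i % 4 = 1) (hn4 : n % 4 = 1)
    (a : Fin (k + 1)) : redeiMatrix n (Fin.cons 2 p) a.succ 0 = 0 := by
  rw [redeiMatrix_apply_of_ne _ _ (Fin.succ_ne_zero a), Fin.cons_zero, Fin.cons_succ,
    primeDisc_two_of_mod_four_one hn4]
  exact kroneckerBit_neg_four_eq_zero (hp a) (h4 a)

/-- Prime-to-prime entries of `RM(−4n)` on the family are Monsky's `A` (`D_b = p_b`, Euler's bit = additive symbol).
[cite: LiMa2008, Def. 0.2 (p. 279)] [cite: IrelandRosen1990, Ch. 5 §1 Prop. 5.1.2] -/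
theorem redeiMatrix_four_succ_succ (hp : ∀ i, (p i).Prime) (hinj : Function.Injective p)
    (h4 : ∀ i, p i % 4 = 1) {a b : Fin (k + 1)} (hab : a ≠ b) :
    redeiMatrix n (Fin.cons 2 p) a.succ b.succ = legendreMatrix p a b := by
  have hp2 : ∀ i, p i ≠ 2 := fun i h => by have := h4 i; omega
  rw [redeiMatrix_apply_of_ne _ _ (fun h => hab (Fin.succ_inj.mp h)), Fin.cons_succ, Fin.cons_succ,
    primeDisc_of_ne_two _ (hp2 b), if_pos (h4 b), legendreMatrix_apply_of_ne p hab]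
  exact kroneckerBit_eq_addLegendreSym (hp a) (hp2 a)
    (natCast_ne_zero_of_prime_ne (hp a) (hp b) fun h => hab.symm (hinj h))

/-- **`RM(−4n)` applied to a vector, on the family**: coordinate of `2` = `Σ_b [p_b ≡ 5 (8)]·(x₂ + x_b)`, prime
coordinates = `A` applied to the prime part — `RM(−4n) = (r cᵀ; 0 A)` in the basis `(2; p₀, …, p_k)`.
[cite: LiMa2008, Def. 0.2 (p. 279); evaluation ours] -/
theorem redeiMatrix_four_mulVec (hp : ∀ i, (p i).Prime) (hinj : Function.Injective p)
    (h4 : ∀ i, p i % 4 = 1) (hn4 : n % 4 = 1) (x : Fin (k + 1 + 1) → ZMod 2) (i : Fin (k + 1 + 1)) :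
    (redeiMatrix n (Fin.cons 2 p) *ᵥ x) i =
      Fin.cases (motive := fun _ => ZMod 2) (∑ b, (if p b % 8 = 5 then (1 : ZMod 2) else 0) * (x 0 + x b.succ))
        (fun a => (legendreMatrix p *ᵥ (x ∘ Fin.succ)) a) i := by
  rw [mulVec_apply_eq_sum_of_diag _ (redeiMatrix_apply_self _ _) x i, Fin.sum_univ_succ]
  refine Fin.cases ?_ (fun a => ?_) i
  · rw [Fin.cases_zero, CharTwo.add_self_eq_zero, mul_zero, zero_add]
    exact Finset.sum_congr rfl fun b _ => by rw [redeiMatrix_four_zero_succ p h4 b]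
  · rw [Fin.cases_succ, redeiMatrix_four_succ_zero p hp h4 hn4 a, zero_mul, zero_add,
      legendreMatrix_mulVec_apply_eq_sum]
    refine Finset.sum_congr rfl fun b _ => ?_
    rcases eq_or_ne a b with rfl | hab
    · simp only [Function.comp_apply, CharTwo.add_self_eq_zero, mul_zero]
    · rw [redeiMatrix_four_succ_succ p hp hinj h4 hab]; rfl

/-- **Kernel of `RM(−4n)` on the class-`5` odd-graph family = `{0, 1}`** (`G(n)` odd, kernel form): the prime part
`ξ` of a null vector has `Aξ = 0`, so `ξ ∈ {0, 1}`, and the `2`-coordinate is forced (`Σ_b c_b = 1`).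
[cite: LiMa2008, Thm. 0.4 (p. 280); evaluation ours] [cite: Feng1996NonCongruent, §2 Lemma 2.2 (p. 74)] -/
theorem redeiMatrix_four_mulVec_eq_zero_iff (hp : ∀ i, (p i).Prime) (hinj : Function.Injective p)
    (h4 : ∀ i, p i % 4 = 1) (h5 : (∏ i, p i) % 8 = 5) (hn4 : n % 4 = 1)
    (hG : ∀ v, legendreMatrix p *ᵥ v = 0 → v = 0 ∨ v = fun _ => 1) (x : Fin (k + 1 + 1) → ZMod 2) :
    redeiMatrix n (Fin.cons 2 p) *ᵥ x = 0 ↔ x = 0 ∨ x = fun _ => 1 := by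
  have hrow := redeiMatrix_four_mulVec p hp hinj h4 hn4 x
  have hc := sum_ite_five_eq_one p h4 h5
  constructor
  · intro hx
    have hA : legendreMatrix p *ᵥ (x ∘ Fin.succ) = 0 := by
      funext a
      have := congr_fun hx a.succ
      rw [hrow, Fin.cases_succ] at this
      exact this
    have h0 := congr_fun hx 0
    rw [hrow, Fin.cases_zero, Pi.zero_apply] at h0
    rcases hG _ hA with hξ | hξ
    · -- prime part zero: `x₂ · Σ c_b = 0`
      have hb : ∀ b : Fin (k + 1), x b.succ = 0 := fun b => congr_fun hξ b
      simp only [hb, add_zero] at h0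
      rw [← Finset.sum_mul, hc, one_mul] at h0
      left
      funext i
      refine Fin.cases ?_ (fun b => ?_) i
      · exact h0
      · exact hb b
    · have hb : ∀ b : Fin (k + 1), x b.succ = 1 := fun b => congr_fun hξ b
      simp only [hb] at h0
      rw [← Finset.sum_mul, hc, one_mul] at h0
      have hx0 : x 0 = 1 := by
        have h01 : ∀ c : ZMod 2, c + 1 = 0 → c = 1 := by decide
        exact h01 _ h0
      right
      funext i
      refine Fin.cases ?_ (fun b => ?_) i
      · exact hx0
      · exact hb b
  · rintro (rfl | rfl)
    · exact Matrix.mulVec_zero _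
    · exact redeiMatrix_mulVec_one _ _

/-- **`#ker RM(−4n) = 2` on the class-`5` odd-graph family, uniformly in `k`** (`rank = t − 1`, `r₄ = 0`).
[cite: LiMa2008, Thm. 0.4 (p. 280)] -/
theorem card_ker_redeiMatrix_four_caseFive (hp : ∀ i, (p i).Prime) (hinj : Function.Injective p)
    (h4 : ∀ i, p i % 4 = 1) (h5 : (∏ i, p i) % 8 = 5) (hn4 : n % 4 = 1)
    (hG : ∀ v, legendreMatrix p *ᵥ v = 0 → v = 0 ∨ v = fun _ => 1) :
    Fintype.card {x : Fin (k + 1 + 1) → ZMod 2 // redeiMatrix n (Fin.cons 2 p) *ᵥ x = 0} = 2 := by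
  rw [Fintype.card_of_subtype ({0, fun _ => 1} : Finset (Fin (k + 1 + 1) → ZMod 2)) (fun x => by
    rw [Finset.mem_insert, Finset.mem_singleton]
    exact (redeiMatrix_four_mulVec_eq_zero_iff p hp hinj h4 h5 hn4 hG x).symm)]
  exact Finset.card_pair fun h => zero_ne_one (congr_fun h 0)

end RedeiFourN

/-- The side conditions of the Rédei door for the tuple `(2; p₀, …, p_k)`: primes, injective, `∏ = 2n` with
`n ≡ 1 (mod 4)`. [cite: LiMa2008, Lemma 0.1 (p. 279)] -/
theorem redei_side_conditions_cons_two (hp : ∀ i, (p i).Prime) (hinj : Function.Injective p)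
    (h4 : ∀ i, p i % 4 = 1) {n : ℕ} (hn : ∏ i, p i = n) (hn4 : n % 4 = 1) :
    (∀ i, ((Fin.cons 2 p : Fin (k + 1 + 1) → ℕ) i).Prime) ∧
      Function.Injective (Fin.cons 2 p : Fin (k + 1 + 1) → ℕ) ∧
      (∏ i, (Fin.cons 2 p : Fin (k + 1 + 1) → ℕ) i) = if n % 4 = 1 then 2 * n else n := by
  refine ⟨fun i => Fin.cases Nat.prime_two (fun a => by rw [Fin.cons_succ]; exact hp a) i, ?_, ?_⟩
  · refine Fin.cons_injective_iff.mpr ⟨?_, hinj⟩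
    rintro ⟨a, ha⟩
    have := h4 a
    omega
  · rw [if_pos hn4, Fin.prod_univ_succ, Fin.cons_zero]
    simp only [Fin.cons_succ]
    rw [hn]

/-- **`ℚ(√−n)` has NO ideal class of order `4` on the class-`5` odd-graph family**, modulo Rédei–Reichardt:
`n = p₀⋯p_k ≡ 5 (mod 8)`, all `pᵢ ≡ 1 (mod 4)`, `G(n)` odd ⟹ `r₄(Cl(ℚ(√−n))) = 0` — the class-group hypothesis
of Li–Liu–Tian 2024 Thm. 1.2, uniformly in `k` (the case `k = 1` is `noIdealClassOfOrderFour_neg_p_mul_q`).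
Also Tian–Yuan–Zhang's hypothesis of Cor. 1.4 ("no ideal classes of exact order 4", case `n ≡ 5` with `B₁`/`A₀`).
[cite: LiMa2008, Thm. 0.4 (p. 280); evaluation ours] [cite: LiLiuTian2024, Thm. 1.2 (hypothesis)] [cite: TianYuanZhang2017, Cor. 1.4] -/
theorem noIdealClassOfOrderFour_caseFive (hR : redeiReichardt_fourTwoCard_classGroup) (hp : ∀ i, (p i).Prime)
    (hinj : Function.Injective p) (h4 : ∀ i, p i % 4 = 1) (h5 : (∏ i, p i) % 8 = 5)
    (hG : ∀ v, legendreMatrix p *ᵥ v = 0 → v = 0 ∨ v = fun _ => 1) {n : ℕ} (hn : ∏ i, p i = n) :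
    NoIdealClassOfOrderFour (-(n : ℤ)) := by
  have hn4 : n % 4 = 1 := by rw [← hn]; omega
  obtain ⟨hq, hqinj, hprod⟩ := redei_side_conditions_cons_two p hp hinj h4 hn hn4
  exact noIdealClassOfOrderFour_of_card_ker hR hq hqinj hprod
    (card_ker_redeiMatrix_four_caseFive p hp hinj h4 h5 hn4 hG)

/-- `g(n) = #2Cl(K)` is ODD for every quadratic `K ∋ √−n` on the class-`5` odd-graph family (`r₄ = 0`), modulo
Rédei–Reichardt. [cite: TianYuanZhang2017, §1 (p0002 L85) and Cor. 1.4] [cite: LiMa2008, Thm. 0.4 (p. 280)] -/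
theorem odd_genusClassNumber_caseFive (hR : redeiReichardt_fourTwoCard_classGroup) (hp : ∀ i, (p i).Prime)
    (hinj : Function.Injective p) (h4 : ∀ i, p i % 4 = 1) (h5 : (∏ i, p i) % 8 = 5)
    (hG : ∀ v, legendreMatrix p *ᵥ v = 0 → v = 0 ∨ v = fun _ => 1) {n : ℕ} (hn : ∏ i, p i = n)
    (K : Type) [Field K] [NumberField K] (hK : IsQuadraticFieldOfSqrt K (-(n : ℤ))) :
    Odd (genusClassNumber K) := by
  have hn4 : n % 4 = 1 := by rw [← hn]; omega
  obtain ⟨hq, hqinj, hprod⟩ := redei_side_conditions_cons_two p hp hinj h4 hn hn4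
  rw [odd_genusClassNumber_iff_of_redeiReichardt hR hq hqinj hprod K hK]
  have h := card_ker_mulVec_eq (redeiMatrix n (Fin.cons 2 p))
  rw [card_ker_redeiMatrix_four_caseFive p hp hinj h4 h5 hn4 hG] at h
  have h1 : k + 1 + 1 - (redeiMatrix n (Fin.cons 2 p)).rank = 1 :=
    Nat.pow_right_injective (le_refl 2) (by simpa using h.symm)
  omega

/-- The hypotheses of Li–Liu–Tian 2024 Thm. 1.2 hold on the family: `n` square-free, `≡ 5 (mod 8)`, all prime
factors `≡ 1 (mod 4)`. [cite: LiLiuTian2024, Thm. 1.2 (hypotheses)] -/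
theorem thm12_hypotheses_caseFive (hp : ∀ i, (p i).Prime) (hinj : Function.Injective p)
    (h4 : ∀ i, p i % 4 = 1) (h5 : (∏ i, p i) % 8 = 5) {n : ℕ} (hn : ∏ i, p i = n) :
    Squarefree n ∧ n % 8 = 5 ∧ ∀ q : ℕ, q.Prime → q ∣ n → q % 4 = 1 := by
  refine ⟨hn ▸ squarefree_prod_of_injective p hp hinj, hn ▸ h5, fun q hq hqn => ?_⟩
  rw [← hn] at hqn
  obtain ⟨i, -, hi⟩ := ((Nat.Prime.prime hq).dvd_finsetProd_iff _).mp hqn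
  rw [(Nat.prime_dvd_prime_iff_eq hq (hp i)).mp hi]
  exact h4 i

/-- **RANK ONE and RANK ∧ SHAFIN ∧ LEAD on the class-`5` odd-graph family**, modulo Rédei–Reichardt and
Li–Liu–Tian 2024 Thm. 1.2: for `n = p₀⋯p_k ≡ 5 (mod 8)`, all `pᵢ ≡ 1 (mod 4)`, `G(n)` odd —
`rank E_n(ℚ) = 1 = ord_{s=1} L(E_n, s)` and `BSDTriple (E_n)`, uniformly in `k`.
[cite: LiLiuTian2024, Thm. 1.2] [cite: LiMa2008, Thm. 0.4 (p. 280)] -/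
theorem bsd_congruentNumberCurve_caseFive (hR : redeiReichardt_fourTwoCard_classGroup)
    (hLLT : thm12_bsd_congruentNumberCurve) (hp : ∀ i, (p i).Prime) (hinj : Function.Injective p)
    (h4 : ∀ i, p i % 4 = 1) (h5 : (∏ i, p i) % 8 = 5)
    (hG : ∀ v, legendreMatrix p *ᵥ v = 0 → v = 0 ∨ v = fun _ => 1) {n : ℕ} (hn : ∏ i, p i = n) :
    haveI := isElliptic_congruentNumberCurve (Squarefree.ne_zero (thm12_hypotheses_caseFive p hp hinj h4 h5 hn).1)
    haveI := isGloballyMinimal_congruentNumberCurve (thm12_hypotheses_caseFive p hp hinj h4 h5 hn).1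
    (congruentNumberCurve n).mordellWeilRank = 1 ∧ (congruentNumberCurve n).analyticRank = 1 ∧
      (congruentNumberCurve n).BSDTriple := by
  obtain ⟨hsq, h8, hfac⟩ := thm12_hypotheses_caseFive p hp hinj h4 h5 hn
  exact bsd_congruentNumberCurve_of_thm12 hLLT hsq h8 hfac
    (noIdealClassOfOrderFour_caseFive p hR hp hinj h4 h5 hG hn)

/-- **`BSD(E_n, ℓ)` for EVERY prime `ℓ` on the class-`5` odd-graph family** (Miller's `BSD(E, p)`), modulo
Rédei–Reichardt and Li–Liu–Tian 2024 Thm. 1.2 — FULL BSD, including `ℓ = 2`, for `n = p₀⋯p_k ≡ 5 (mod 8)`,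
all `pᵢ ≡ 1 (mod 4)`, `G(n)` odd, uniformly in `k`; the `k = 1` case is `forall_bsdp_congruentNumberCurve_p_mul_q`.
[cite: LiLiuTian2024, Thm. 1.2] [cite: LiMa2008, Thm. 0.4 (p. 280)] [cite: Miller2011LMS, §1 and Def. 1.1] -/
theorem forall_bsdp_congruentNumberCurve_caseFive (hR : redeiReichardt_fourTwoCard_classGroup)
    (hLLT : thm12_bsd_congruentNumberCurve) (hp : ∀ i, (p i).Prime) (hinj : Function.Injective p)
    (h4 : ∀ i, p i % 4 = 1) (h5 : (∏ i, p i) % 8 = 5)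
    (hG : ∀ v, legendreMatrix p *ᵥ v = 0 → v = 0 ∨ v = fun _ => 1) {n : ℕ} (hn : ∏ i, p i = n)
    (ℓ : ℕ) (hℓ : ℓ.Prime) :
    haveI := isElliptic_congruentNumberCurve (Squarefree.ne_zero (thm12_hypotheses_caseFive p hp hinj h4 h5 hn).1)
    haveI := isGloballyMinimal_congruentNumberCurve (thm12_hypotheses_caseFive p hp hinj h4 h5 hn).1
    BSDp (congruentNumberCurve n) ℓ := by
  obtain ⟨hsq, h8, hfac⟩ := thm12_hypotheses_caseFive p hp hinj h4 h5 hn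
  haveI := isElliptic_congruentNumberCurve (Squarefree.ne_zero hsq)
  haveI := isGloballyMinimal_congruentNumberCurve hsq
  exact forall_bsdp_congruentNumberCurve_of_thm12 hLLT hsq h8 hfac
    (noIdealClassOfOrderFour_caseFive p hR hp hinj h4 h5 hG hn) ℓ hℓ

/-! ## §3 Tian's class-`5` family (`p₀ ≡ 5`, `pᵢ ≡ 1 (mod 8)`): condition (1.1) from the graph, and Thm. 1.3 -/

section RedeiEightN

variable {n : ℕ}

/-- `D₂ = −8` for `D = −8n`, `n ≡ 5 (mod 8)` (`2n ≡ 2 (mod 8)`). [cite: LiMa2008, Lemma 0.1 (p. 279)] -/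
theorem primeDisc_two_mul_two_of_five (hn8 : n % 8 = 5) : primeDisc (2 * n) 2 = -8 := by
  unfold primeDisc
  rw [if_pos rfl, if_neg (by omega), if_neg (by omega)]

/-- `(−8/q) = (2/q)` for a prime `q ≡ 1 (mod 4)`: `kroneckerBit (−8) q = [q ≡ 5 (mod 8)]`.
[cite: IrelandRosen1990, Ch. 5 §2 Prop. 5.2.2] -/
theorem kroneckerBit_neg_eight_eq_ite {q : ℕ} (hq : q.Prime) (h4 : q % 4 = 1) :
    kroneckerBit (-8) q = if q % 8 = 5 then 1 else 0 := by
  have hq2 : q ≠ 2 := by omega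
  have hodd : Odd q := Nat.odd_iff.mpr (by omega)
  have h8 : ((-8 : ℤ) : ZMod q) ≠ 0 := by
    rw [show (-8 : ℤ) = -(8 : ℤ) by rfl, Int.cast_neg]
    exact neg_ne_zero.mpr (eight_ne_zero hq hq2)
  rw [kroneckerBit_eq_addLegendreSym hq hq2 h8, ← addLegendreSym_two_eq_ite h4, addLegendreSym_def,
    addLegendreSym_def]
  have hgcd : Int.gcd 2 q = 1 := by
    have h := Int.gcd_natCast_natCast 2 q
    rw [(Nat.coprime_primes Nat.prime_two hq).mpr (Ne.symm hq2)] at h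
    simpa using h
  rw [show (-8 : ℤ) = -(2 ^ 2 * 2) by norm_num, jacobiSym.neg _ hodd, ZMod.χ₄_nat_one_mod_four h4, one_mul,
    jacobiSym.mul_left, jacobiSym.pow_left, jacobiSym.sq_one hgcd, one_mul]

/-- Row of `2` in `RM(−8n)` on Tian's class-`5` family: `r_{2,b} = [D_b ≡ 5 (mod 8)] = [b = 0]`.
[cite: LiMa2008, Def. 0.2 (p. 279)] [cite: Cox2013, §5.B] -/
theorem redeiMatrix_eight_zero_succ (h50 : p 0 % 8 = 5) (h1 : ∀ i, i ≠ 0 → p i % 8 = 1) (b : Fin (k + 1)) :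
    redeiMatrix (2 * n) (Fin.cons 2 p) 0 b.succ = if b = 0 then 1 else 0 := by
  have h4 : ∀ i, p i % 4 = 1 := fun i => by
    rcases eq_or_ne i 0 with rfl | hi
    · omega
    · have := h1 i hi; omega
  rw [redeiMatrix_four_zero_succ p h4 b]
  rcases eq_or_ne b 0 with rfl | hb
  · rw [if_pos h50, if_pos rfl]
  · rw [if_neg (by have := h1 b hb; omega), if_neg hb]

/-- Column of `2` in `RM(−8n)` on Tian's class-`5` family: `r_{a,2} = [(−8/pₐ) = −1] = [a = 0]`.
[cite: LiMa2008, Def. 0.2 (p. 279)] [cite: IrelandRosen1990, Ch. 5 §2 Prop. 5.2.2] -/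
theorem redeiMatrix_eight_succ_zero (hp : ∀ i, (p i).Prime) (h50 : p 0 % 8 = 5)
    (h1 : ∀ i, i ≠ 0 → p i % 8 = 1) (hn8 : n % 8 = 5) (a : Fin (k + 1)) :
    redeiMatrix (2 * n) (Fin.cons 2 p) a.succ 0 = if a = 0 then 1 else 0 := by
  have h4 : p a % 4 = 1 := by
    rcases eq_or_ne a 0 with rfl | ha
    · omega
    · have := h1 a ha; omega
  rw [redeiMatrix_apply_of_ne _ _ (Fin.succ_ne_zero a), Fin.cons_zero, Fin.cons_succ,
    primeDisc_two_mul_two_of_five hn8, kroneckerBit_neg_eight_eq_ite (hp a) h4]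
  rcases eq_or_ne a 0 with rfl | ha
  · rw [if_pos h50, if_pos rfl]
  · rw [if_neg (by have := h1 a ha; omega), if_neg ha]

/-- **`RM(−8n)` applied to a vector, on Tian's class-`5` family**: `RM(−8n) = (1 e₀ᵀ; e₀ A + E₀₀)` in the basis
`(2; p₀, …, p_k)`: coordinate of `2` = `x₂ + x_{p₀}`, coordinate of `pₐ` = `[a = 0](x_{p₀} + x₂) + (Aξ)ₐ`.
[cite: LiMa2008, Def. 0.2 (p. 279); evaluation ours] [cite: Tian2014, proof of Lemma 5.1 (arXiv p. 28)] -/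
theorem redeiMatrix_eight_mulVec (hp : ∀ i, (p i).Prime) (hinj : Function.Injective p) (h50 : p 0 % 8 = 5)
    (h1 : ∀ i, i ≠ 0 → p i % 8 = 1) (hn8 : n % 8 = 5) (x : Fin (k + 1 + 1) → ZMod 2) (i : Fin (k + 1 + 1)) :
    (redeiMatrix (2 * n) (Fin.cons 2 p) *ᵥ x) i =
      Fin.cases (motive := fun _ => ZMod 2) (x 0 + x (Fin.succ 0))
        (fun a => (if a = 0 then x (Fin.succ 0) + x 0 else 0) + (legendreMatrix p *ᵥ (x ∘ Fin.succ)) a) i := by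
  have h4 : ∀ i, p i % 4 = 1 := fun i => by
    rcases eq_or_ne i 0 with rfl | hi
    · omega
    · have := h1 i hi; omega
  rw [mulVec_apply_eq_sum_of_diag _ (redeiMatrix_apply_self _ _) x i, Fin.sum_univ_succ]
  refine Fin.cases ?_ (fun a => ?_) i
  · rw [Fin.cases_zero, CharTwo.add_self_eq_zero, mul_zero, zero_add]
    rw [Finset.sum_eq_single (0 : Fin (k + 1))]
    · rw [redeiMatrix_eight_zero_succ p h50 h1, if_pos rfl, one_mul]
    · intro b _ hb
      rw [redeiMatrix_eight_zero_succ p h50 h1, if_neg hb, zero_mul]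
    · intro h; exact absurd (Finset.mem_univ _) h
  · rw [Fin.cases_succ, redeiMatrix_eight_succ_zero p hp h50 h1 hn8 a, legendreMatrix_mulVec_apply_eq_sum]
    congr 1
    · rcases eq_or_ne a 0 with rfl | ha
      · rw [if_pos rfl, if_pos rfl, one_mul]
      · rw [if_neg ha, if_neg ha, zero_mul]
    · refine Finset.sum_congr rfl fun b _ => ?_
      rcases eq_or_ne a b with rfl | hab
      · simp only [Function.comp_apply, CharTwo.add_self_eq_zero, mul_zero]
      · rw [redeiMatrix_four_succ_succ p hp hinj h4 hab]; rfl

/-- **Kernel of `RM(−8n)` on Tian's class-`5` family = `{0, 1}`** (`G(n)` odd): `2` elements, `r₄ = 0` —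
`dim_{𝔽₂} 𝒜[4]/𝒜[2] = 0` for `𝒜 = Cl(ℚ(√−2n))`, `n ≡ 5 ≡ −3 (mod 8)`.
[cite: Tian2014, Lemma 5.1 (arXiv p. 28 L2–L16)] [cite: LiMa2008, Thm. 0.4 (p. 280)] -/
theorem card_ker_redeiMatrix_eight_caseFive (hp : ∀ i, (p i).Prime) (hinj : Function.Injective p)
    (h50 : p 0 % 8 = 5) (h1 : ∀ i, i ≠ 0 → p i % 8 = 1) (hn8 : n % 8 = 5)
    (hG : ∀ v, legendreMatrix p *ᵥ v = 0 → v = 0 ∨ v = fun _ => 1) :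
    Fintype.card {x : Fin (k + 1 + 1) → ZMod 2 // redeiMatrix (2 * n) (Fin.cons 2 p) *ᵥ x = 0} = 2 := by
  have h01 : ∀ c d : ZMod 2, c + d = 0 → c = d := by decide
  rw [Fintype.card_of_subtype ({0, fun _ => 1} : Finset (Fin (k + 1 + 1) → ZMod 2)) (fun x => ?_)]
  · exact Finset.card_pair fun h => zero_ne_one (congr_fun h 0)
  rw [Finset.mem_insert, Finset.mem_singleton]
  have hrow := redeiMatrix_eight_mulVec p hp hinj h50 h1 hn8 x
  constructor
  · rintro (rfl | rfl)
    · exact Matrix.mulVec_zero _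
    · exact redeiMatrix_mulVec_one _ _
  · intro hx
    have h0 := congr_fun hx 0
    rw [hrow, Fin.cases_zero, Pi.zero_apply] at h0
    have hx0 : x 0 = x (Fin.succ 0) := h01 _ _ h0
    have hA : legendreMatrix p *ᵥ (x ∘ Fin.succ) = 0 := by
      funext a
      have := congr_fun hx a.succ
      have hz : (if a = 0 then x (Fin.succ 0) + x 0 else 0) = 0 := by
        split_ifs
        · rw [← hx0]; exact CharTwo.add_self_eq_zero _
        · rfl
      rw [hrow, Fin.cases_succ, Pi.zero_apply, hz, zero_add] at this
      exact this
    rcases hG _ hA with hξ | hξ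
    · left
      funext i
      refine Fin.cases ?_ (fun b => ?_) i
      · rw [hx0]; exact congr_fun hξ 0
      · exact congr_fun hξ b
    · right
      funext i
      refine Fin.cases ?_ (fun b => ?_) i
      · rw [hx0]; exact congr_fun hξ 0
      · exact congr_fun hξ b

end RedeiEightN

/-- **Tian 2014, Lemma 5.1 (direction ⇐) for the class-`5` family, as a THEOREM modulo Rédei–Reichardt.**  For
`n = p₀p₁⋯p_k` with `p₀ ≡ 5`, `pᵢ ≡ 1 (mod 8)` and `G(n)` odd (kernel form), every quadratic `K ∋ √−2n` satisfies
Tian's condition (1.1) in the case `n ≡ ±3 (mod 8)`: `dim_{𝔽₂} 𝒜[4]/𝒜[2] = 0`, i.e. `#(2𝒜 ∩ 𝒜[2]) = 1`.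
[cite: Tian2014, Lemma 5.1 (arXiv:1210.8231 p. 28, L2–L16) and Thm. 1.3 (1.1)] [cite: LiMa2008, Thm. 0.4 (p. 280)] -/
theorem condition11_caseFive (hR : redeiReichardt_fourTwoCard_classGroup) (hp : ∀ i, (p i).Prime)
    (hinj : Function.Injective p) (h50 : p 0 % 8 = 5) (h1 : ∀ i, i ≠ 0 → p i % 8 = 1)
    (hG : ∀ v, legendreMatrix p *ᵥ v = 0 → v = 0 ∨ v = fun _ => 1) {n : ℕ} (hn : ∏ i, p i = n)
    (K : Type) [Field K] [NumberField K] (hK : IsQuadraticFieldOfSqrt K (-(2 * n : ℤ))) :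
    Condition11 n K := by
  have h4 : ∀ i, p i % 4 = 1 := fun i => by
    rcases eq_or_ne i 0 with rfl | hi
    · omega
    · have := h1 i hi; omega
  have hn8 : n % 8 = 5 := by
    rw [← hn, Fin.prod_univ_succ, Nat.mul_mod, Finset.prod_nat_mod]
    have h : ∀ i : Fin k, p i.succ % 8 = 1 := fun i => h1 _ (Fin.succ_ne_zero i)
    simp only [h, Finset.prod_const_one, Nat.one_mod, h50]
  obtain ⟨hq, hqinj, -⟩ := redei_side_conditions_cons_two p hp hinj h4 hn (by omega)
  refine condition11_of_card_ker (p := Fin.cons 2 p) hR hq hqinj ?_ ?_ K hK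
  · rw [Fin.prod_univ_succ, Fin.cons_zero]
    simp only [Fin.cons_succ]
    rw [hn]
  · rw [if_pos (Or.inr hn8)]
    exact card_ker_redeiMatrix_eight_caseFive p hp hinj h50 h1 hn8 hG

/-- **Tian 2014 Thm 1.3 on the class-`5` graph-form family, condition (1.1) discharged** (modulo the displayed
Thm 1.3 `h13` and Rédei–Reichardt `hR`): `rank E_n(ℚ) = 1 = ord_{s=1} L(E_n, s)`, `Ш(E_n)` finite of odd order,
for `n = p₀p₁⋯p_k`, `p₀ ≡ 5`, `pᵢ ≡ 1 (mod 8)`, `G(n)` odd; `K := GenusField (2n)`.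
[cite: Tian2014, Thm. 1.3 with Lemma 5.1 (arXiv p. 2, L5–L15; p. 28, L2–L16)] [cite: LiMa2008, Thm. 0.4] -/
theorem thm13_caseFive (h13 : thm13_rank_one_and_sha_odd) (hR : redeiReichardt_fourTwoCard_classGroup)
    (hp : ∀ i, (p i).Prime) (hinj : Function.Injective p) (h50 : p 0 % 8 = 5)
    (h1 : ∀ i, i ≠ 0 → p i % 8 = 1) (hG : ∀ v, legendreMatrix p *ᵥ v = 0 → v = 0 ∨ v = fun _ => 1)
    {n : ℕ} (hn : ∏ i, p i = n) :
    (congruentNumberCurve n).mordellWeilRank = 1 ∧ (congruentNumberCurve n).analyticRank = 1 ∧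
      Finite (congruentNumberCurve n).sha ∧ Odd (Nat.card (congruentNumberCurve n).sha) := by
  have hp2 : ∀ i, p i ≠ 2 := fun i h => by
    rcases eq_or_ne i 0 with rfl | hi
    · omega
    · have := h1 i hi; omega
  have hn8 : n % 8 = 5 := by
    rw [← hn, Fin.prod_univ_succ, Nat.mul_mod, Finset.prod_nat_mod]
    have h : ∀ i : Fin k, p i.succ % 8 = 1 := fun i => h1 _ (Fin.succ_ne_zero i)
    simp only [h, Finset.prod_const_one, Nat.one_mod, h50]
  have hK : IsQuadraticFieldOfSqrt (GenusField (2 * n)) (-(2 * n : ℤ)) := by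
    have h := isQuadraticFieldOfSqrt_genusField (d := 2 * n) (by omega)
    have hc : (-((2 * n : ℕ) : ℤ)) = -(2 * n : ℤ) := by push_cast; ring
    rwa [hc] at h
  exact h13 k p hp hp2 hinj h1 n hn.symm (GenusField (2 * n)) hK
    (condition11_caseFive p hR hp hinj h50 h1 hG hn _ hK) n (Or.inl rfl) (Or.inl hn8)

end Literature.NumberTheory.EllipticCurves.Tian2014

end
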